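import Summits.MatrixMultiplication.MatrixMultiplication.Theses.EPRFaces
import Summits.MatrixMultiplication.MatrixMultiplication.Theorems.EPRFacesConverse
import Summits.MatrixMultiplication.MatrixMultiplication.Theorems.EPRFacesAssembly
import Literature.Computability.AlgebraicComplexity.RectangularExponentBounds
import Literature.Computability.AlgebraicComplexity.RectangularExponentAsymptoticRank
import Summits.MatrixMultiplication.MatrixMultiplication.Theorems.EPRFacesFaceMaximiserStubConvexLift

/-!
# Route `EPRFaces`, crux stmt-MatrixMultiplication-10894 `FaceMaximiser` (B) — status lemmas

Helper file (`--supports stmt-MatrixMultiplication-10894`) of the line `registered`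
(`Cruxes/FaceMaximiser/Lines/birth.lean`).  B in rank form:
`∀ k ≥ 1, ∀ β, R(⟨n,n,n^k⟩) = O(n^β) → ω + (k − 1) ≤ β`.

What is recorded here, sorry-free:

* `faceAtTwo_of_faceMaximiser` / `faceMaximiser_of_faceAtTwo` / `faceMaximiser_iff_faceAtTwo` —
  **normal form**: B is equivalent to its `k = 2` instance B₂ (the line's load-bearing stub
  statement `stub_faceAtTwo`: every `β` with `R(⟨n,n,n²⟩) = O(n^β)` has `ω + 1 ≤ β`).  `→` is
  instantiation; `←` is the line's assembly: `k = 1` is `ω = inf admissibleExponents ≤ β`; for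
  `k ≥ 2` pick an admissible `γ < ω + ε/(k−1)` of `⟨n,n,n⟩`, lift `(β, γ)` to the admissible
  exponent `((k−2)γ+β)/(k−1)` of `⟨n,n,n²⟩` by the landed convexity stub `stub_convexLift`
  (Lotti–Romani 1983 §1; `EPRFacesFaceMaximiserStubConvexLift.lean`, p147325), apply B₂, let `ε → 0`.
* `faceAtTwo_iff_omegaRect` / `faceMaximiser_iff_omegaRect_two` — the same in the tree's `ω(1,1,k)`
  vocabulary: B ↔ B₂ ↔ `omegaRect ℂ 1 1 2 = omega ℂ + 1` (`≤` is blocking, `omegaRect_one_one_le_add`).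
* `omega_le_of_faceMaximiser` — **record transfer**: under B, any certified rectangular bound
  `∀ ε > 0, R(⟨n,n,n^k⟩) = O(n^{u+ε})` (i.e. `ω(1,1,k) ≤ u`) becomes the square bound
  `ω ≤ u − (k − 1)`; the route's `Dichotomy` is the instance `k = 3`, `u = 4.198809`.
* `faceMaximiser_iff_matrixMultiplication` / `faceMaximiser_iff_omega_eq_two` — B follows from
  `ω(ℂ) = 2` (`converse_proof`), and together with E = `PerfectAmortisation` gives it back
  (`EPRFaces.closes`); so **modulo E the crux B is equivalent to the summit statement**
  `MatrixMultiplication`.  E is a theorem in print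
  (Coppersmith 1982, SIAM J. Comput. 11, p. 471: for each `β > 0` there is `α > 1` with
  `R(⟨N,N,N^α⟩) = O(N^{α+1+β} (log N)^{3/2})`; also the easy Coppersmith–Winograd tensor with
  `q = 2k + 2` gives `ω(1,1,k) − k − 1 ≤ ln 2 / ln(2k+2)`), being formalised on
  stmt-MatrixMultiplication-10893; it enters here only as an explicit hypothesis.
-/

-- `Summit.MatrixMultiplication.MatrixMultiplication.…` repeats a component by design (single-conjunct summit)
set_option linter.dupNamespace false

namespace Summit.MatrixMultiplication.MatrixMultiplication.Theorems

open Filter Asymptotics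
open Literature.Computability.AlgebraicComplexity
open Summit.MatrixMultiplication.MatrixMultiplication.Theses.EPRFaces

namespace EPRFacesFaceMaximiser

/-- **B ⇒ B at `k = 2`** (the normal form of the crux, statement of the line's stub
`stub_faceAtTwo`): every `β` with `R(⟨n,n,n²⟩) = O(n^β)` satisfies `ω + 1 ≤ β`. -/
theorem faceAtTwo_of_faceMaximiser (hB : FaceMaximiser) :
    ∀ β : ℝ,
      ((fun n : ℕ => (tensorRank (matMulTensor ℂ n n (n ^ 2)) : ℝ)) =O[atTop]
        fun n : ℕ => (n : ℝ) ^ β) →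
      omega ℂ + 1 ≤ β := by
  intro β hβ
  have h := hB 2 (by norm_num) β hβ
  norm_num at h
  linarith

/-- **B at `k = 2` ⇒ B** (the line's assembly `FaceMaximiser_of` with the convexity stub
discharged by the landed `stub_convexLift`).  `k = 1`: `β` is an admissible exponent of `⟨n,n,n⟩`
and `ω` is their infimum.  `k ≥ 2`: for `ε > 0` choose an admissible `γ < ω + ε/(k−1)` of
`⟨n,n,n⟩` (`exists_lt_of_csInf_lt`), lift `(β, γ)` to the admissible exponent `((k−2)γ+β)/(k−1)`
of `⟨n,n,n²⟩` (`stub_convexLift`), apply the `k = 2` bound: `(ω+1)(k−1) ≤ (k−2)γ + β <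
(k−2)ω + ε + β`, i.e. `ω + k − 1 < β + ε`. -/
theorem faceMaximiser_of_faceAtTwo
    (hface : ∀ β : ℝ,
      ((fun n : ℕ => (tensorRank (matMulTensor ℂ n n (n ^ 2)) : ℝ)) =O[atTop]
        fun n : ℕ => (n : ℝ) ^ β) →
      omega ℂ + 1 ≤ β) :
    FaceMaximiser := by
  intro k hk β hβ
  rcases Nat.lt_or_ge k 2 with hk2 | hk2
  · -- `k = 1`
    obtain rfl : k = 1 := by omega
    have hfun : (fun n : ℕ => (tensorRank (matMulTensor ℂ n n (n ^ 1)) : ℝ)) =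
        fun n : ℕ => (tensorRank (matMulTensor ℂ n n n) : ℝ) :=
      funext fun n => by rw [tensorRank_matMulTensor_congr ℂ rfl rfl (pow_one n)]
    have hmem : β ∈ admissibleExponents ℂ := by
      rw [hfun] at hβ
      exact hβ
    have hle : omega ℂ ≤ β := csInf_le (admissibleExponents_bddBelow ℂ) hmem
    norm_num
    exact hle
  · -- `k ≥ 2`
    have hk2' : (2 : ℝ) ≤ (k : ℝ) := by exact_mod_cast hk2
    have hpos : (0 : ℝ) < (k : ℝ) - 1 := by linarith
    have hnn : (0 : ℝ) ≤ (k : ℝ) - 2 := by linarith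
    refine le_of_forall_pos_lt_add fun ε hε => ?_
    obtain ⟨γ, hγ, hγlt⟩ := exists_lt_of_csInf_lt (admissibleExponents_nonempty ℂ)
      (lt_add_of_pos_right (sInf (admissibleExponents ℂ)) (div_pos hε hpos))
    have hγO : (fun n : ℕ => (tensorRank (matMulTensor ℂ n n n) : ℝ)) =O[atTop]
        fun n : ℕ => (n : ℝ) ^ γ := hγ
    have h := hface _ (stub_convexLift k hk2 β γ hβ hγO)
    rw [le_div_iff₀ hpos] at h
    have hω : sInf (admissibleExponents ℂ) = omega ℂ := rfl
    rw [hω] at hγlt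
    have h1 : ((k : ℝ) - 2) * γ ≤ ((k : ℝ) - 2) * (omega ℂ + ε / ((k : ℝ) - 1)) :=
      mul_le_mul_of_nonneg_left hγlt.le hnn
    have h2 : ((k : ℝ) - 2) * (ε / ((k : ℝ) - 1)) < ε := by
      rw [mul_div_assoc', div_lt_iff₀ hpos]
      nlinarith
    nlinarith [h, h1, h2]

/-- **Normal form of the crux**: B ↔ (B at `k = 2`), i.e. `FaceMaximiser` is equivalent to the
single statement "every `β` with `R(⟨n,n,n²⟩) = O(n^β)` has `ω + 1 ≤ β`" (`ω(1,1,2) = ω + 1`: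
multiplying an `n × n` matrix by an `n × n²` matrix is asymptotically as expensive as `n` square
products). -/
theorem faceMaximiser_iff_faceAtTwo :
    FaceMaximiser ↔
      ∀ β : ℝ,
        ((fun n : ℕ => (tensorRank (matMulTensor ℂ n n (n ^ 2)) : ℝ)) =O[atTop]
          fun n : ℕ => (n : ℝ) ^ β) →
        omega ℂ + 1 ≤ β :=
  ⟨faceAtTwo_of_faceMaximiser, faceMaximiser_of_faceAtTwo⟩

/-- Re-indexing `⌈n^1⌉ = n`, `⌈n^2⌉ = n²`: the rank function of `rectAdmissibleExponents ℂ 1 1 2` is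
the rank-form function of `⟨n,n,n²⟩`. -/
theorem rankFun_rectDim_one_one_two :
    (fun n : ℕ => (tensorRank (matMulTensor ℂ (rectDim n 1) (rectDim n 1) (rectDim n 2)) : ℝ)) =
      fun n : ℕ => (tensorRank (matMulTensor ℂ n n (n ^ 2)) : ℝ) := by
  funext n
  have h2 : rectDim n (2 : ℝ) = n ^ 2 := by exact_mod_cast rectDim_natCast n 2
  rw [tensorRank_matMulTensor_congr ℂ (rectDim_one n) (rectDim_one n) h2]

/-- Rank-form `O(n^β)` bounds on `R(⟨n,n,n²⟩)` are exactly memberships `β ∈ rectAdmissibleExponents ℂ 1 1 2`. -/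
theorem isBigO_sq_iff_mem_rectAdmissibleExponents (β : ℝ) :
    ((fun n : ℕ => (tensorRank (matMulTensor ℂ n n (n ^ 2)) : ℝ)) =O[atTop]
        fun n : ℕ => (n : ℝ) ^ β) ↔
      β ∈ rectAdmissibleExponents ℂ 1 1 2 := by
  rw [rectAdmissibleExponents, Set.mem_setOf_eq, rankFun_rectDim_one_one_two]

/-- **B at `k = 2` in the tree's `ω(1,1,k)` vocabulary**: (every `β` with `R(⟨n,n,n²⟩) = O(n^β)`
has `ω + 1 ≤ β`) ↔ `ω(1,1,2) = ω + 1` (`omegaRect ℂ 1 1 2 = omega ℂ + 1`).  `≤` always holds by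
blocking (`omegaRect_one_one_le_add`: `ω(1,1,2) ≤ ω(1,1,1) + 1`, and `ω(1,1,1) = ω`); the content
is `ω + 1 ≤ ω(1,1,2) = inf (rectAdmissibleExponents ℂ 1 1 2)` (`le_csInf` / `csInf_le`). -/
theorem faceAtTwo_iff_omegaRect :
    (∀ β : ℝ,
        ((fun n : ℕ => (tensorRank (matMulTensor ℂ n n (n ^ 2)) : ℝ)) =O[atTop]
          fun n : ℕ => (n : ℝ) ^ β) →
        omega ℂ + 1 ≤ β) ↔
      omegaRect ℂ 1 1 2 = omega ℂ + 1 := by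
  have hle : omegaRect ℂ 1 1 2 ≤ omega ℂ + 1 := by
    have h := omegaRect_one_one_le_add ℂ (p := 2) (q := 1) (by norm_num)
    rw [omegaRect_one_one_one] at h
    norm_num at h
    exact h
  constructor
  · intro hB
    refine le_antisymm hle (le_csInf (rectAdmissibleExponents_nonempty ℂ 1 1 2) fun β hβ => ?_)
    exact hB β ((isBigO_sq_iff_mem_rectAdmissibleExponents β).2 hβ)
  · intro h β hβ
    rw [← h]
    exact csInf_le (rectAdmissibleExponents_one_one_bddBelow ℂ 2)
      ((isBigO_sq_iff_mem_rectAdmissibleExponents β).1 hβ)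

/-- **The crux in one equation**: `FaceMaximiser ↔ ω(1,1,2) = ω + 1`. -/
theorem faceMaximiser_iff_omegaRect_two : FaceMaximiser ↔ omegaRect ℂ 1 1 2 = omega ℂ + 1 :=
  faceMaximiser_iff_faceAtTwo.trans faceAtTwo_iff_omegaRect

/-- **Record transfer under B**: if B holds and `u` bounds the exponent of `⟨n,n,n^k⟩` in rank
form (`∀ ε > 0, R(⟨n,n,n^k⟩) = O(n^{u+ε})`, i.e. `ω(1,1,k) ≤ u`), then `ω ≤ u − (k − 1)`:
B at `k` applied to the admissible exponent `u + ε` gives `ω + (k − 1) ≤ u + ε` for every `ε > 0`.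
The route's `Dichotomy` (stmt-10897) is the instance `k = 3`, `u = 4.198809`. -/
theorem omega_le_of_faceMaximiser (hB : FaceMaximiser) {k : ℕ} (hk : 1 ≤ k) {u : ℝ}
    (hu : ∀ ε : ℝ, 0 < ε →
      (fun n : ℕ => (tensorRank (matMulTensor ℂ n n (n ^ k)) : ℝ)) =O[atTop]
        fun n : ℕ => (n : ℝ) ^ (u + ε)) :
    omega ℂ ≤ u - ((k : ℝ) - 1) := by
  refine le_of_forall_pos_lt_add fun ε hε => ?_
  have h := hB k hk (u + ε / 2) (hu (ε / 2) (half_pos hε))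
  linarith

/-- **Modulo E, the crux B is the summit**: `PerfectAmortisation → (FaceMaximiser ↔ ω(ℂ) = 2)`.
E (perfect amortisation, `∀ ε > 0 ∃ k ≥ 1, R(⟨n,n,n^k⟩) = O(n^{k+1+ε})`) is a 1982 result of
Coppersmith (SIAM J. Comput. 11, p. 471: for each `β > 0` some `α > 1` has
`R(⟨N,N,N^α⟩) = O(N^{α+1+β}(log N)^{3/2})`) and is the crux stmt-MatrixMultiplication-10893 of this
route; it is an explicit hypothesis here, so this records — inside the tree — that a proof of B is a proof
of `ω = 2` given E, and a refutation of B is a proof of `ω > 2`. -/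
theorem faceMaximiser_iff_matrixMultiplication (hE : PerfectAmortisation) :
    FaceMaximiser ↔ _root_.MatrixMultiplication :=
  -- the route (CLOSED·exhausted 2026-08-17) no longer carries `closes`; the landed assembly
  -- `eprFaces_assembly_proof : FaceMaximiser → PerfectAmortisation → MatrixMultiplication` is the same six lines
  ⟨fun hB => eprFaces_assembly_proof hB hE, fun hMM => (converse_proof hMM).1⟩

/-- The same equivalence read on `ω` itself: given E, `B ↔ ω(ℂ) = 2`. -/
theorem faceMaximiser_iff_omega_eq_two :
    PerfectAmortisation → (FaceMaximiser ↔ omega ℂ = 2) := fun hE =>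
  (faceMaximiser_iff_matrixMultiplication hE).trans _root_.MatrixMultiplication_iff

end EPRFacesFaceMaximiser

end Summit.MatrixMultiplication.MatrixMultiplication.Theorems
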